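import Literature.Combinatorics.Additive.TripleProductProperty
import Summits.MatrixMultiplication.MatrixMultiplication.Theorems.SnSubsetDichotomyThresholdSubsetTriplesPairFactorisation

/-!
# `SnSubsetDichotomy.ThresholdSubsetTriples` — stub `stub_ownerPairNoThird` (owner pair admits no third class)

Crux `stmt-MatrixMultiplication-10882` (`ThresholdSubsetTriples`), line `interleaved-subsignature-ascent`,
negative design rule of census c3a: the two complementary OWNER chain classes
`S_A = subsig (ownerSystem L)` and `S_B = subsig (ownerSystem Lᶜ)` factorise `S_n` exactly
(`stub_pairFactorisation`, landed in `SnSubsetDichotomyThresholdSubsetTriplesPairFactorisation`), so their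
mixed quotient set `S_A S_A⁻¹ S_B S_B⁻¹` is all of `S_n`; consequently a third set `U` completing them to a
triple with the triple product property has at most one element (its quotient set `U U⁻¹` must avoid
everything but `1`).

Proof (explicit, elementary): for `u, u' ∈ U` pick any pair `(a₀, b₀) ∈ S_A × S_B` (factor `1`) and factor
`a₀⁻¹ (u' u⁻¹) b₀ = a⁻¹ b`; then `a₀ a⁻¹ · b b₀⁻¹ · u u'⁻¹ = 1`, and the TPP forces `u = u'`.
Mathlib + the two landed line files only.
-/

-- `Summit.<Summit>.<Problem>` is the tree's mandated summit-side namespace; for this single-conjunct summit the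
-- two components coincide, so the file silences `dupNamespace` (same as the vocabulary file it imports).
set_option linter.dupNamespace false
set_option autoImplicit false

namespace Summit.MatrixMultiplication.MatrixMultiplication.Theorems.ThresholdSubsetTriples

open Literature.Combinatorics.Additive

/-- Every permutation is a mixed quotient `a₀ a⁻¹ · b b₀⁻¹` of the two owner classes, for ANY fixed
`a₀ ∈ S_A`, `b₀ ∈ S_B` (from the exact pair factorisation `stub_pairFactorisation`). -/
theorem ownerPair_mixedQuotient_surj {n : ℕ} (L : Finset (Fin n)) {a₀ b₀ : Equiv.Perm (Fin n)}
    (σ : Equiv.Perm (Fin n)) :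
    ∃ a ∈ subsig (ownerSystem L), ∃ b ∈ subsig (ownerSystem Lᶜ), a₀ * a⁻¹ * (b * b₀⁻¹) = σ := by
  obtain ⟨⟨a, b⟩, ⟨ha, hb, hab⟩, -⟩ := stub_pairFactorisation L (a₀⁻¹ * σ * b₀)
  refine ⟨a, ha, b, hb, ?_⟩
  calc a₀ * a⁻¹ * (b * b₀⁻¹) = a₀ * (a⁻¹ * b) * b₀⁻¹ := by group
    _ = σ := by rw [hab]; group

/-- **Stub `stub_ownerPairNoThird` (census c3a, negative design rule).**  If `(S_A, S_B, U)` has the triple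
product property for the complementary owner chain classes `S_A = subsig (ownerSystem L)`,
`S_B = subsig (ownerSystem Lᶜ)`, then `|U| ≤ 1`: an exactly factorising pair admits no third class. -/
theorem stub_ownerPairNoThird {n : ℕ} (L : Finset (Fin n)) (U : Finset (Equiv.Perm (Fin n)))
    (hT : TripleProductProperty (subsig (ownerSystem L)) (subsig (ownerSystem Lᶜ)) U) : U.card ≤ 1 := by
  rw [Finset.card_le_one]
  intro u hu u' hu'
  -- any pair of the two (nonempty) owner classes
  obtain ⟨⟨a₀, b₀⟩, ⟨ha₀, hb₀, -⟩, -⟩ := stub_pairFactorisation L 1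
  -- realise `(u u'⁻¹)⁻¹ = u' u⁻¹` as a mixed quotient `a₀ a⁻¹ · b b₀⁻¹`
  obtain ⟨a, ha, b, hb, hab⟩ := ownerPair_mixedQuotient_surj L (a₀ := a₀) (b₀ := b₀) (u' * u⁻¹)
  have hrel : a₀ * a⁻¹ * (b * b₀⁻¹) * (u * u'⁻¹) = 1 := by
    rw [hab]; group
  exact (hT a₀ ha₀ a ha b hb b₀ hb₀ u hu u' hu' hrel).2.2

end Summit.MatrixMultiplication.MatrixMultiplication.Theorems.ThresholdSubsetTriples
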